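import Summits.QuantumFields.QCD.Theses.HeatSlicedQuarks

/-!
# Exact real modes of the tree's `wilsonDirac` on the `1⁴` torus in a constant NON-ABELIAN field;
# kernel-certified facts about `stub_smoothFieldFloor` / `stub_lowModesHugRoughness` of `Lines/low-mode-quarantine.lean`
(crux `Summit.QuantumFields.QCD.Theses.HeatSlicedQuarks.RobustYangMillsHandover`, stmt-QuantumFields-8892; drefute seat)

SU(2)-block family of `SU(3)` links `U₀ = [[c, is, 0], [is, c, 0], [0, 0, 1]]`, `U₁ = [[c, s, 0], [−s, c, 0], [0, 0, 1]]`,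
`U₂ = U₃ = 1` (`c² + s² = 1`) on the one-point torus: the colour-0 / spin-0 basis vector is an EXACT eigenvector of
`wilsonDirac ρ₃ U m 1` with REAL eigenvalue `m + 2(1 − c)` (`wilsonDirac_blockConfig_mulVec_single`: the Wilson term gives
`2(1 − c)`, the γ-term `is(γ₀ ⊗ σ₁ + γ₁ ⊗ σ₂)` annihilates a 4-dimensional subspace since its square is
`2s²(1 + γ₀γ₁ ⊗ iσ₃)`); the only non-trivial plaquettes are `U₀U₁U₀⁻¹U₁⁻¹` and its inverse, deficit `4s⁴`.
* `smoothFieldFloor_false_without_smoothness` — `stub_smoothFieldFloor` with its plaquette-smallness hypothesis DROPPED is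
  false: `(c, s) = (4/5, 3/5)`, `m = −2/5 = −m₀` is an exact ZERO MODE of `D_W` inside the route's mass window.
* `smoothFieldFloor_false_with_eps_half_sq` — the admissible `ε₀(m₀)` must be `< m₀²/2` somewhere: at `m₀ = 4/25`,
  `(c, s) = (40/41, 9/41)`, `m = −4/25` all deficits are `≤ 26244/2825761 < 8/625` while `‖D_W v‖² = (114/1025)²‖v‖²
  < (m₀²/2)‖v‖²` (the floor drops by `2(1−c)|m| ≈ η|m|`, `η = ‖1 − U_p‖ = 2s²`: `ε₀ = O(m₀²)` is forced already at
  `L = 1`; Neuberger's printed bound gives sufficiency at `ε₀ ≈ 10⁻⁴m₀²`).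
* `lowModesHugRoughness_false_with_eps_large` — the same zero mode against `stub_lowModesHugRoughness`: with
  `ε₀ = (13/4)m₀²` no plaquette is rough, the distance hypothesis is vacuous, and `C e^{−cn}` fails for large `n`.
Nothing here asserts a Theses decl positively.
-/

namespace Summit.QuantumFields.QCD.Theorems.RobustYangMillsHandover.Negative

open Literature.MathematicalPhysics.QuantumLattice Literature.MathematicalPhysics.QuantumFieldTheory
open Literature.Probability.LatticeModels Matrix Finset Complex

local notation "SU3" => Matrix.specialUnitaryGroup (Fin 3) ℂ
local notation "ρ₃" => fundamentalRep (Fin 3)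

/-! ## The SU(2)-block links -/

/-- `U₀ = exp(iθσ₁) ⊕ 1` with `(cos θ, sin θ) = (c, s)`. -/
def linkX (c s : ℝ) : Matrix (Fin 3) (Fin 3) ℂ :=
  !![(c : ℂ), (s : ℂ) * I, 0; (s : ℂ) * I, (c : ℂ), 0; 0, 0, 1]

/-- `U₁ = exp(iθσ₂) ⊕ 1` with `(cos θ, sin θ) = (c, s)`. -/
def linkY (c s : ℝ) : Matrix (Fin 3) (Fin 3) ℂ :=
  !![(c : ℂ), (s : ℂ), 0; -(s : ℂ), (c : ℂ), 0; 0, 0, 1]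

/-- `U₀ ∈ SU(3)` on the circle `c² + s² = 1`. [folklore] -/
theorem linkX_mem {c s : ℝ} (h : c ^ 2 + s ^ 2 = 1) : linkX c s ∈ Matrix.specialUnitaryGroup (Fin 3) ℂ := by
  have hre : c * c + s * s = 1 := by nlinarith [h]
  rw [Matrix.mem_specialUnitaryGroup_iff, Matrix.mem_unitaryGroup_iff]
  constructor
  · ext i j
    fin_cases i <;> fin_cases j
    all_goals simp [linkX, Matrix.mul_apply, Fin.sum_univ_three, Matrix.star_apply, Complex.ext_iff]
    all_goals nlinarith [hre]
  · simp [linkX, Matrix.det_fin_three, Complex.ext_iff]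
    all_goals nlinarith [hre]

/-- `U₁ ∈ SU(3)` on the circle `c² + s² = 1`. [folklore] -/
theorem linkY_mem {c s : ℝ} (h : c ^ 2 + s ^ 2 = 1) : linkY c s ∈ Matrix.specialUnitaryGroup (Fin 3) ℂ := by
  have hre : c * c + s * s = 1 := by nlinarith [h]
  rw [Matrix.mem_specialUnitaryGroup_iff, Matrix.mem_unitaryGroup_iff]
  constructor
  · ext i j
    fin_cases i <;> fin_cases j
    all_goals simp [linkY, Matrix.mul_apply, Fin.sum_univ_three, Matrix.star_apply, Complex.ext_iff]
    all_goals nlinarith [hre]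
  · simp [linkY, Matrix.det_fin_three, Complex.ext_iff]
    all_goals nlinarith [hre]

/-- `U₀† ` explicitly. [folklore] -/
theorem star_linkX (c s : ℝ) :
    star (linkX c s) = !![(c : ℂ), -((s : ℂ) * I), 0; -((s : ℂ) * I), (c : ℂ), 0; 0, 0, 1] := by
  ext i j
  fin_cases i <;> fin_cases j
  all_goals simp [linkX, Matrix.star_apply]

/-- `U₁†` explicitly. [folklore] -/
theorem star_linkY (c s : ℝ) :
    star (linkY c s) = !![(c : ℂ), -(s : ℂ), 0; (s : ℂ), (c : ℂ), 0; 0, 0, 1] := by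
  ext i j
  fin_cases i <;> fin_cases j
  all_goals simp [linkY, Matrix.star_apply]

/-- The links as a function of the direction: `U₀, U₁` the SU(2)-block pair, `U₂ = U₃ = 1`. -/
def blockLink {c s : ℝ} (h : c ^ 2 + s ^ 2 = 1) : Fin 4 → SU3 :=
  ![⟨linkX c s, linkX_mem h⟩, ⟨linkY c s, linkY_mem h⟩, 1, 1]

/-- The constant non-abelian configuration on the torus of side `L` (used at `L = 1`). -/
def blockConfig {c s : ℝ} (h : c ^ 2 + s ^ 2 = 1) (L : ℕ) : GaugeConfig 4 L SU3 :=
  fun e => blockLink h e.2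

/-- The block configuration reads the direction only. [folklore] -/
@[simp] theorem blockConfig_apply {c s : ℝ} (h : c ^ 2 + s ^ 2 = 1) (L : ℕ) (x : TorusSite 4 L) (μ : Fin 4) :
    blockConfig h L (x, μ) = blockLink h μ := rfl

/-- Direction `0` carries `U₀`. [folklore] -/
@[simp] theorem coe_blockLink_zero {c s : ℝ} (h : c ^ 2 + s ^ 2 = 1) :
    ((blockLink h 0 : SU3) : Matrix (Fin 3) (Fin 3) ℂ) = linkX c s := rfl
/-- Direction `1` carries `U₁`. [folklore] -/
@[simp] theorem coe_blockLink_one {c s : ℝ} (h : c ^ 2 + s ^ 2 = 1) :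
    ((blockLink h 1 : SU3) : Matrix (Fin 3) (Fin 3) ℂ) = linkY c s := rfl
/-- Direction `2` carries `1`. [folklore] -/
@[simp] theorem blockLink_two {c s : ℝ} (h : c ^ 2 + s ^ 2 = 1) : blockLink h 2 = 1 := rfl
/-- Direction `3` carries `1`. [folklore] -/
@[simp] theorem blockLink_three {c s : ℝ} (h : c ^ 2 + s ^ 2 = 1) : blockLink h 3 = 1 := rfl

/-- In `SU(3)` the inverse is the conjugate transpose (Mathlib: `inv := star`). [folklore] -/
theorem coe_inv_su3 (g : SU3) : ((g⁻¹ : SU3) : Matrix (Fin 3) (Fin 3) ℂ) = star (g : Matrix (Fin 3) (Fin 3) ℂ) := rfl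

/-! ## Column `0` of the tree's Euclidean gamma matrices -/

/-- `(γ_μ)_{α0}`: `γ₀ e₀ = i e₃`, `γ₁ e₀ = −e₃`, `γ₂ e₀ = i e₂`, `γ₃ e₀ = e₂` (chiral basis of the tree). [folklore] -/
theorem euclideanGamma_apply_zero (μ α : Fin 4) :
    euclideanGamma μ α 0 = ![![0, 0, 0, I], ![0, 0, 0, -1], ![0, 0, I, 0], ![0, 0, 1, 0]] μ α := by
  fin_cases μ <;> fin_cases α <;>
    simp [euclideanGamma, spinHalfPauli, Matrix.kroneckerMap_apply, finProdFinEquiv,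
      Fin.divNat, Fin.modNat]

/-! ## The exact eigenvector -/

section Column

variable {c s : ℝ} (h : c ^ 2 + s ^ 2 = 1) (m : ℝ) (x : TorusSite 4 1)

/-- **Column `(x, 0, 0)` of `D_W` on the `1⁴` torus in the block configuration**: it is
`(m + 2(1 − c))` on the diagonal and `0` elsewhere. [folklore] -/
theorem wilsonDirac_blockConfig_col (p : TorusSite 4 1 × Fin 3 × Fin 4) :
    wilsonDirac ρ₃ (blockConfig h 1) m 1 p (x, 0, 0) =
      if p = (x, 0, 0) then (((m + 2 * (1 - c)) : ℝ) : ℂ) else 0 := by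
  obtain ⟨y, a, α⟩ := p
  have hy : y = x := Subsingleton.elim _ _
  subst hy
  have hshift : ∀ μ : Fin 4, Literature.MathematicalPhysics.QuantumFieldTheory.Site.shift y μ = y := fun μ => Subsingleton.elim _ _
  fin_cases a <;> fin_cases α
  all_goals
    simp [wilsonDirac, Matrix.of_apply, hshift, Fin.sum_univ_four, fundamentalRep_apply, coe_inv_su3,
      Matrix.star_apply, euclideanGamma_apply_zero, linkX, linkY, Matrix.one_apply, Complex.ext_iff]
  all_goals ring

/-- **Exact eigenvector.** `D_W(blockConfig, m) e_{(x,0,0)} = (m + 2(1 − c)) e_{(x,0,0)}` on the `1⁴` torus. [folklore] -/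
theorem wilsonDirac_blockConfig_mulVec_single :
    (wilsonDirac ρ₃ (blockConfig h 1) m 1).mulVec (Pi.single (x, (0 : Fin 3), (0 : Fin 4)) 1) =
      (((m + 2 * (1 - c)) : ℝ) : ℂ) • Pi.single (x, (0 : Fin 3), (0 : Fin 4)) 1 := by
  rw [Matrix.mulVec_single_one]
  ext p
  rw [Matrix.col_apply, wilsonDirac_blockConfig_col h m x p, Pi.smul_apply, smul_eq_mul]
  by_cases hp : p = (x, 0, 0)
  · subst hp; simp
  · simp [hp]

/-- The squared norms along the eigenvector: `Σ‖(D_W v)_i‖² = (m + 2(1−c))² Σ‖v_i‖²`. [folklore] -/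
theorem sum_norm_sq_wilsonDirac_blockConfig_single :
    ∑ i, ‖(wilsonDirac ρ₃ (blockConfig h 1) m 1).mulVec (Pi.single (x, (0 : Fin 3), (0 : Fin 4)) (1 : ℂ)) i‖ ^ 2 =
      (m + 2 * (1 - c)) ^ 2 * ∑ i, ‖(Pi.single (x, (0 : Fin 3), (0 : Fin 4)) (1 : ℂ) :
        TorusSite 4 1 × Fin 3 × Fin 4 → ℂ) i‖ ^ 2 := by
  rw [wilsonDirac_blockConfig_mulVec_single h m x, Finset.mul_sum]
  refine Finset.sum_congr rfl fun i _ => ?_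
  rw [Pi.smul_apply, smul_eq_mul, norm_mul, mul_pow, Complex.norm_real, Real.norm_eq_abs, sq_abs]

/-- `Σ‖v_i‖² ≥ 1` for the basis vector. [folklore] -/
theorem one_le_sum_norm_sq_single :
    (1 : ℝ) ≤ ∑ i, ‖(Pi.single (x, (0 : Fin 3), (0 : Fin 4)) (1 : ℂ) : TorusSite 4 1 × Fin 3 × Fin 4 → ℂ) i‖ ^ 2 := by
  have h1 : ‖(Pi.single (x, (0 : Fin 3), (0 : Fin 4)) (1 : ℂ) : TorusSite 4 1 × Fin 3 × Fin 4 → ℂ) (x, 0, 0)‖ ^ 2 = 1 := by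
    simp
  rw [← h1]
  exact Finset.single_le_sum (f := fun i => ‖(Pi.single (x, (0 : Fin 3), (0 : Fin 4)) (1 : ℂ) :
    TorusSite 4 1 × Fin 3 × Fin 4 → ℂ) i‖ ^ 2) (fun i _ => by positivity) (Finset.mem_univ _)

end Column

/-! ## The plaquettes of the block configuration -/

section Plaquettes

/-- On the `1⁴` torus the plaquette holonomy is the group commutator of the two links. [folklore] -/
theorem plaquetteHolonomy_blockConfig_one {c s : ℝ} (h : c ^ 2 + s ^ 2 = 1) (y : TorusSite 4 1) (μ ν : Fin 4) :
    plaquetteHolonomy (blockConfig h 1) y μ ν =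
      blockLink h μ * blockLink h ν * (blockLink h μ)⁻¹ * (blockLink h ν)⁻¹ := by
  have hshift : ∀ μ : Fin 4, Literature.MathematicalPhysics.QuantumFieldTheory.Site.shift y μ = y :=
    fun μ => Subsingleton.elim _ _
  simp [plaquetteHolonomy, hshift]

/-- Real part of the trace of the one non-trivial commutator `U₀U₁U₀†U₁†`, as a raw polynomial. [folklore] -/
theorem re_trace_commutator_XY (c s : ℝ) :
    ((linkX c s * linkY c s * star (linkX c s) * star (linkY c s)).trace).re =
      2 * c ^ 4 - 2 * s ^ 4 + 4 * c ^ 2 * s ^ 2 + 1 := by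
  rw [star_linkX, star_linkY]
  simp [linkX, linkY, Matrix.trace_fin_three]
  ring

/-- On the circle `c² + s² = 1` the deficit of that commutator is `4s⁴`. [folklore] -/
theorem deficit_commutator_XY {c s : ℝ} (h : c ^ 2 + s ^ 2 = 1) :
    3 - ((linkX c s * linkY c s * star (linkX c s) * star (linkY c s)).trace).re = 4 * s ^ 4 := by
  rw [re_trace_commutator_XY]
  linear_combination (-2 * (c ^ 2 + s ^ 2 + 1)) * h

/-- The trace of the identity of `SU(3)` has real part `3`. [folklore] -/
theorem re_trace_one_su3 : ((((1 : SU3) : SU3) : Matrix (Fin 3) (Fin 3) ℂ).trace).re = 3 := by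
  simp

/-- Every plaquette deficit of the block configuration on the `1⁴` torus is `≤ 4s⁴` (it is `0` or `4s⁴`). [folklore] -/
theorem deficit_blockConfig_one_le {c s : ℝ} (h : c ^ 2 + s ^ 2 = 1) (y : TorusSite 4 1) (μ ν : Fin 4) :
    3 - ((ρ₃ (plaquetteHolonomy (blockConfig h 1) y μ ν)).trace).re ≤ 4 * s ^ 4 := by
  have hs4 : 0 ≤ 4 * s ^ 4 := by positivity
  rw [plaquetteHolonomy_blockConfig_one h y μ ν, fundamentalRep_apply]
  -- the four shapes of commutators that occur
  have htriv : ∀ g : SU3, 3 - (((g * g * g⁻¹ * g⁻¹ : SU3) : Matrix (Fin 3) (Fin 3) ℂ).trace).re ≤ 4 * s ^ 4 := by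
    intro g
    have hg : g * g * g⁻¹ * g⁻¹ = 1 := by group
    rw [hg, re_trace_one_su3]
    linarith
  have hone_right : ∀ g : SU3, 3 - (((g * 1 * g⁻¹ * 1⁻¹ : SU3) : Matrix (Fin 3) (Fin 3) ℂ).trace).re ≤ 4 * s ^ 4 := by
    intro g
    have hg : g * 1 * g⁻¹ * 1⁻¹ = (1 : SU3) := by group
    rw [hg, re_trace_one_su3]
    linarith
  have hone_left : ∀ g : SU3, 3 - (((1 * g * 1⁻¹ * g⁻¹ : SU3) : Matrix (Fin 3) (Fin 3) ℂ).trace).re ≤ 4 * s ^ 4 := by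
    intro g
    have hg : 1 * g * 1⁻¹ * g⁻¹ = (1 : SU3) := by group
    rw [hg, re_trace_one_su3]
    linarith
  have hXY : 3 - (((blockLink h 0 * blockLink h 1 * (blockLink h 0)⁻¹ * (blockLink h 1)⁻¹ : SU3) :
      Matrix (Fin 3) (Fin 3) ℂ).trace).re ≤ 4 * s ^ 4 := by
    rw [Submonoid.coe_mul, Submonoid.coe_mul, Submonoid.coe_mul, coe_inv_su3, coe_inv_su3,
      coe_blockLink_zero, coe_blockLink_one, deficit_commutator_XY h]
  have hYX : 3 - (((blockLink h 1 * blockLink h 0 * (blockLink h 1)⁻¹ * (blockLink h 0)⁻¹ : SU3) :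
      Matrix (Fin 3) (Fin 3) ℂ).trace).re ≤ 4 * s ^ 4 := by
    have hinv : blockLink h 1 * blockLink h 0 * (blockLink h 1)⁻¹ * (blockLink h 0)⁻¹ =
        (blockLink h 0 * blockLink h 1 * (blockLink h 0)⁻¹ * (blockLink h 1)⁻¹)⁻¹ := by group
    rw [hinv, coe_inv_su3, Matrix.star_eq_conjTranspose, Matrix.trace_conjTranspose, Complex.star_def,
      Complex.conj_re]
    exact hXY
  fin_cases μ <;> fin_cases ν
  · exact htriv _
  · exact hXY
  · exact hone_right _
  · exact hone_right _
  · exact hYX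
  · exact htriv _
  · exact hone_right _
  · exact hone_right _
  · exact hone_left _
  · exact hone_left _
  · exact htriv _
  · exact htriv _
  · exact hone_left _
  · exact hone_left _
  · exact htriv _
  · exact htriv _

end Plaquettes

/-! ## The two statements about `stub_smoothFieldFloor` -/

/-- `stub_smoothFieldFloor` at a given `(m₀, ε₀)` (its `∃ ε₀`-body; a named variant of a line stub, not a
literature fact). -/
def SmoothFieldFloorAt (m₀ ε₀ : ℝ) : Prop :=
  ∀ (L : ℕ) [NeZero L] (U : GaugeConfig 4 L (Matrix.specialUnitaryGroup (Fin 3) ℂ)) (m : ℝ),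
    m ∈ Set.Icc (-(1 / 2 : ℝ)) 1 → m₀ ≤ |m| →
    (∀ (y : TorusSite 4 L) (μ ν : Fin 4),
      3 - ((fundamentalRep (Fin 3) (plaquetteHolonomy U y μ ν)).trace).re ≤ ε₀) →
      ∀ v : TorusSite 4 L × Fin 3 × Fin 4 → ℂ,
        m₀ ^ 2 / 2 * ∑ i, ‖v i‖ ^ 2 ≤ ∑ i, ‖(wilsonDirac (fundamentalRep (Fin 3)) U m 1).mulVec v i‖ ^ 2

/-- `stub_smoothFieldFloor` with the plaquette-smallness hypothesis DROPPED (a named variant of a line stub,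
not a literature fact). -/
def SmoothFieldFloorWithoutSmoothness : Prop :=
  ∀ m₀ : ℝ, 0 < m₀ → m₀ ≤ 1 →
    ∀ (L : ℕ) [NeZero L] (U : GaugeConfig 4 L (Matrix.specialUnitaryGroup (Fin 3) ℂ)) (m : ℝ),
      m ∈ Set.Icc (-(1 / 2 : ℝ)) 1 → m₀ ≤ |m| →
        ∀ v : TorusSite 4 L × Fin 3 × Fin 4 → ℂ,
          m₀ ^ 2 / 2 * ∑ i, ‖v i‖ ^ 2 ≤ ∑ i, ‖(wilsonDirac (fundamentalRep (Fin 3)) U m 1).mulVec v i‖ ^ 2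

/-- Pythagoras for the first witness. [folklore] -/
theorem pyth_4_3 : (4 / 5 : ℝ) ^ 2 + (3 / 5) ^ 2 = 1 := by norm_num
/-- Pythagoras for the second witness. [folklore] -/
theorem pyth_40_9 : (40 / 41 : ℝ) ^ 2 + (9 / 41) ^ 2 = 1 := by norm_num

/-- **The plaquette-smallness hypothesis of `stub_smoothFieldFloor` is load-bearing**, with an exact
in-window zero mode: `(c,s) = (4/5,3/5)`, `m = −2/5`. [folklore] -/
theorem smoothFieldFloor_false_without_smoothness : ¬ SmoothFieldFloorWithoutSmoothness := by
  intro hS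
  have key := hS (2 / 5) (by norm_num) (by norm_num) 1 (blockConfig pyth_4_3 1) (-(2 / 5))
    ⟨by norm_num, by norm_num⟩ (by norm_num [abs_of_neg])
    (Pi.single ((0 : TorusSite 4 1), (0 : Fin 3), (0 : Fin 4)) 1)
  rw [sum_norm_sq_wilsonDirac_blockConfig_single pyth_4_3 (-(2 / 5)) 0] at key
  have hS1 := one_le_sum_norm_sq_single (0 : TorusSite 4 1)
  norm_num at key
  linarith

/-- **`ε₀ = m₀²/2` is NOT admissible in `stub_smoothFieldFloor`** (so `ε₀(m₀) = O(m₀²)` with a constant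
`< 1/2` is forced, already on the `1⁴` torus): `m₀ = 4/25`, `(c,s) = (40/41, 9/41)`, `m = −4/25`. [folklore] -/
theorem smoothFieldFloor_false_with_eps_half_sq :
    ¬ ∀ m₀ : ℝ, 0 < m₀ → m₀ ≤ 1 → SmoothFieldFloorAt m₀ (m₀ ^ 2 / 2) := by
  intro hS
  have hsmooth : ∀ (y : TorusSite 4 1) (μ ν : Fin 4),
      3 - ((ρ₃ (plaquetteHolonomy (blockConfig pyth_40_9 1) y μ ν)).trace).re ≤ (4 / 25 : ℝ) ^ 2 / 2 := by
    intro y μ ν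
    refine (deficit_blockConfig_one_le pyth_40_9 y μ ν).trans ?_
    norm_num
  have key := hS (4 / 25) (by norm_num) (by norm_num) 1 (blockConfig pyth_40_9 1) (-(4 / 25))
    ⟨by norm_num, by norm_num⟩ (by norm_num [abs_of_neg]) hsmooth
    (Pi.single ((0 : TorusSite 4 1), (0 : Fin 3), (0 : Fin 4)) 1)
  rw [sum_norm_sq_wilsonDirac_blockConfig_single pyth_40_9 (-(4 / 25)) 0] at key
  have hS1 := one_le_sum_norm_sq_single (0 : TorusSite 4 1)
  norm_num at key
  nlinarith [key, hS1]

/-! ## The same witness against `stub_lowModesHugRoughness` with a too generous `ε₀` -/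

/-- `stub_lowModesHugRoughness` at given constants `(m₀, ε₀, c, C)` (its `∃ ε₀ c C`-body; a named variant of a
line stub, not a literature fact). -/
def LowModesHugRoughnessAt (m₀ ε₀ c C : ℝ) : Prop :=
  ∀ (L : ℕ) [NeZero L] (U : GaugeConfig 4 L (Matrix.specialUnitaryGroup (Fin 3) ℂ)) (m : ℝ),
    m ∈ Set.Icc (-(1 / 2 : ℝ)) 1 → m₀ ≤ |m| →
    ∀ (v : TorusSite 4 L × Fin 3 × Fin 4 → ℂ) (e : ℝ), 0 ≤ e → e ≤ m₀ ^ 2 / 4 →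
      ((wilsonDirac (fundamentalRep (Fin 3)) U m 1)ᴴ *
          wilsonDirac (fundamentalRep (Fin 3)) U m 1).mulVec v = (e : ℂ) • v →
        ∀ (x : TorusSite 4 L) (n : ℕ),
          (∀ y : TorusSite 4 L,
            (∃ μ ν : Fin 4, ε₀ ≤ 3 - ((fundamentalRep (Fin 3) (plaquetteHolonomy U y μ ν)).trace).re) →
              n ≤ torusDist x y) →
          ∑ a : Fin 3, ∑ α : Fin 4, ‖v (x, a, α)‖ ^ 2 ≤ C * Real.exp (-(c * n)) * ∑ i, ‖v i‖ ^ 2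

/-- `Σ_i ‖(e_j)_i‖² = 1`. [folklore] -/
theorem sum_norm_sq_single_one {ι : Type*} [Fintype ι] [DecidableEq ι] (j : ι) :
    ∑ i, ‖(Pi.single j (1 : ℂ) : ι → ℂ) i‖ ^ 2 = 1 := by
  rw [Finset.sum_eq_single j]
  · simp
  · intro i _ hij
    simp [Pi.single_eq_of_ne hij]
  · intro hj
    exact absurd (Finset.mem_univ j) hj

/-- **`ε₀ = (13/4)·m₀²` is NOT admissible in `stub_lowModesHugRoughness`** (whatever `c, C`): at `m₀ = 2/5`,
`(c,s) = (4/5,3/5)`, `m = −2/5` the exact zero mode is an `e = 0` eigenvector of `H = D_Wᴴ D_W`, every plaquette deficit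
is `≤ 324/625 < 13/25 = ε₀`, so no plaquette is `ε₀`-rough, the distance hypothesis holds for every `n`, and the bound
`C e^{−cn}` fails for `n` large. (For this family `4s⁴ = (1+c)² (2(1−c))²`, i.e. `ε₀(m₀) < (1+c)² m₀² → 4m₀²`.) [folklore] -/
theorem lowModesHugRoughness_false_with_eps_large :
    ¬ ∀ m₀ : ℝ, 0 < m₀ → m₀ ≤ 1 → ∃ c C : ℝ, 0 < c ∧ 0 < C ∧ LowModesHugRoughnessAt m₀ (13 / 4 * m₀ ^ 2) c C := by
  intro hS
  obtain ⟨c, C, hc, hC, hmain⟩ := hS (2 / 5) (by norm_num) (by norm_num)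
  set N : ℕ := ⌈C / c⌉₊ + 1 with hN
  set v : TorusSite 4 1 × Fin 3 × Fin 4 → ℂ := Pi.single ((0 : TorusSite 4 1), (0 : Fin 3), (0 : Fin 4)) 1 with hv
  -- the zero mode
  have hD : (wilsonDirac ρ₃ (blockConfig pyth_4_3 1) (-(2 / 5)) 1).mulVec v = 0 := by
    rw [hv, wilsonDirac_blockConfig_mulVec_single pyth_4_3 (-(2 / 5)) 0]
    norm_num
  have heig : ((wilsonDirac ρ₃ (blockConfig pyth_4_3 1) (-(2 / 5)) 1)ᴴ *
      wilsonDirac ρ₃ (blockConfig pyth_4_3 1) (-(2 / 5)) 1).mulVec v = ((0 : ℝ) : ℂ) • v := by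
    rw [← Matrix.mulVec_mulVec, hD, Matrix.mulVec_zero]
    simp
  -- no plaquette is ε₀-rough
  have hdist : ∀ y : TorusSite 4 1,
      (∃ μ ν : Fin 4, 13 / 4 * (2 / 5 : ℝ) ^ 2 ≤
        3 - ((ρ₃ (plaquetteHolonomy (blockConfig pyth_4_3 1) y μ ν)).trace).re) →
        N ≤ torusDist (0 : TorusSite 4 1) y := by
    rintro y ⟨μ, ν, hμν⟩
    have hle := deficit_blockConfig_one_le pyth_4_3 y μ ν
    norm_num at hμν hle
    linarith
  have key := hmain 1 (blockConfig pyth_4_3 1) (-(2 / 5)) ⟨by norm_num, by norm_num⟩ (by norm_num [abs_of_neg])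
    v 0 le_rfl (by norm_num) heig 0 N hdist
  -- evaluate: LHS ≥ 1, Σ‖v_i‖² = 1
  rw [hv, sum_norm_sq_single_one, mul_one] at key
  have hLHS : (1 : ℝ) ≤ ∑ a : Fin 3, ∑ α : Fin 4,
      ‖(Pi.single ((0 : TorusSite 4 1), (0 : Fin 3), (0 : Fin 4)) (1 : ℂ) : TorusSite 4 1 × Fin 3 × Fin 4 → ℂ)
        ((0 : TorusSite 4 1), a, α)‖ ^ 2 := by
    have h00 : ‖(Pi.single ((0 : TorusSite 4 1), (0 : Fin 3), (0 : Fin 4)) (1 : ℂ) :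
        TorusSite 4 1 × Fin 3 × Fin 4 → ℂ) ((0 : TorusSite 4 1), (0 : Fin 3), (0 : Fin 4))‖ ^ 2 = 1 := by simp
    have hinner : (1 : ℝ) ≤ ∑ α : Fin 4,
        ‖(Pi.single ((0 : TorusSite 4 1), (0 : Fin 3), (0 : Fin 4)) (1 : ℂ) : TorusSite 4 1 × Fin 3 × Fin 4 → ℂ)
          ((0 : TorusSite 4 1), (0 : Fin 3), α)‖ ^ 2 := by
      rw [← h00]
      exact Finset.single_le_sum (f := fun α : Fin 4 => ‖(Pi.single ((0 : TorusSite 4 1), (0 : Fin 3), (0 : Fin 4))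
        (1 : ℂ) : TorusSite 4 1 × Fin 3 × Fin 4 → ℂ) ((0 : TorusSite 4 1), (0 : Fin 3), α)‖ ^ 2)
        (fun i _ => by positivity) (Finset.mem_univ _)
    refine hinner.trans ?_
    exact Finset.single_le_sum (f := fun a : Fin 3 => ∑ α : Fin 4, ‖(Pi.single ((0 : TorusSite 4 1), (0 : Fin 3),
      (0 : Fin 4)) (1 : ℂ) : TorusSite 4 1 × Fin 3 × Fin 4 → ℂ) ((0 : TorusSite 4 1), a, α)‖ ^ 2)
      (fun i _ => by positivity) (Finset.mem_univ _)
  -- `C e^{-cN} < 1`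
  have hN1 : C < c * (N : ℝ) := by
    have h1 : C / c ≤ (⌈C / c⌉₊ : ℝ) := Nat.le_ceil _
    have h2 : (N : ℝ) = (⌈C / c⌉₊ : ℝ) + 1 := by simp [hN]
    rw [h2, mul_add, mul_one]
    have : C ≤ c * (⌈C / c⌉₊ : ℝ) := by
      calc C = c * (C / c) := by field_simp
        _ ≤ c * (⌈C / c⌉₊ : ℝ) := by exact mul_le_mul_of_nonneg_left h1 hc.le
    linarith
  have hexp : c * (N : ℝ) < Real.exp (c * (N : ℝ)) := by
    have := Real.add_one_le_exp (c * (N : ℝ))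
    linarith
  have hlt : C * Real.exp (-(c * (N : ℝ))) < 1 := by
    rw [Real.exp_neg]
    have hpos : 0 < Real.exp (c * (N : ℝ)) := Real.exp_pos _
    rw [mul_inv_lt_iff₀ hpos]
    linarith
  linarith

end Summit.QuantumFields.QCD.Theorems.RobustYangMillsHandover.Negative
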